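import Summits.CriticalPhenomena.CardyFormulaZ2.Theorems.CardyIKTransportIKLinearTransportSDEPlumb2
import Summits.CriticalPhenomena.CardyFormulaZ2.Theorems.CardyIKTransportIKLinearTransportSDECore5

/-!
# Stub `stub_StripDiagramExchange` — plumbing part 3: the core bits inside the coded gauge

Continues `…SDEPlumb2`. Gluing two independent samples of a product measure along any set of coordinates gives a sample
(`SDE.infinitePi_glue`); the middle coordinates `SDE.Amid i` (column bit of cell column `i+1`, all row bits, the three
face fields on face columns `i, i+1`); the embedding `SDE.ιc i τ` of the core bit space into the coded gauge and the law
of the core bits read off the gauge (`SDE.map_coreOf : PJ.map (coreOf i τ) = P`); and THE STRIP OF THE CODED OBSERVABLES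
IS THE EXPLICIT STRIP MODEL read off the core bits (`SDE.stripDiagram_ObsJ`).
-/

set_option autoImplicit false

noncomputable section

namespace Summit.CriticalPhenomena.CardyFormulaZ2.Theorems.IKLinearTransport.PinnedDiagramExchange

open scoped Classical MeasureTheory ENNReal ProbabilityTheory BigOperators
open MeasureTheory Literature.Probability.Percolation Literature.Probability.LatticeModels

namespace SDE

/-! ## §4 Gluing two independent samples along a set of coordinates -/

/-- Glue: coordinates in `A` from the second sample, the others from the first. [folklore] -/
def glue {ι X : Type*} (A : Set ι) (b₁ b₂ : ι → X) : ι → X := fun j => if j ∈ A then b₂ j else b₁ j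

/-- GLUING LEMMA: gluing two independent samples of a product measure along any set of coordinates gives a sample. [folklore] -/
theorem infinitePi_glue {ι X : Type*} [MeasurableSpace X] (μ : ι → Measure X) [∀ i, IsProbabilityMeasure (μ i)] (A : Set ι) :
    ((Measure.infinitePi μ).prod (Measure.infinitePi μ)).map (fun p => glue A p.1 p.2) = Measure.infinitePi μ := by
  have hmeas : Measurable (fun p : (ι → X) × (ι → X) => glue A p.1 p.2) := measurable_pi_lambda _ fun j => by
    by_cases hj : j ∈ A
    · simp only [glue, hj, if_true]; fun_prop
    · simp only [glue, hj, if_false]; fun_prop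
  refine Measure.eq_infinitePi μ fun I t ht => ?_
  rw [Measure.map_apply hmeas (.pi I.countable_toSet fun j _ => ht j)]
  have : (fun p : (ι → X) × (ι → X) => glue A p.1 p.2) ⁻¹' Set.pi ↑I t =
      Set.pi ↑(I.filter (· ∉ A)) t ×ˢ Set.pi ↑(I.filter (· ∈ A)) t := by
    ext ⟨ω, η⟩
    simp only [Set.mem_preimage, Set.mem_pi, Finset.mem_coe, Set.mem_prod, Finset.mem_filter, glue]
    constructor
    · intro h
      refine ⟨fun j hj => ?_, fun j hj => ?_⟩
      · simpa [hj.2] using h j hj.1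
      · simpa [hj.2] using h j hj.1
    · rintro ⟨h1, h2⟩ j hj
      by_cases hjs : j ∈ A
      · rw [if_pos hjs]; exact h2 j ⟨hj, hjs⟩
      · rw [if_neg hjs]; exact h1 j ⟨hj, hjs⟩
  rw [this, Measure.prod_prod, Measure.infinitePi_pi _ (fun j _ => ht j), Measure.infinitePi_pi _ (fun j _ => ht j),
    mul_comm, Finset.prod_filter_mul_prod_filter_not]

/-! ## §5 The core bits inside the coded gauge -/

/-- THE MIDDLE COORDINATES at `i`: the column bit of cell column `i+1`, all row bits, and the three face fields on
face columns `i, i+1` (everything an exchange at `i` may resample). [folklore] -/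
def Amid (i : ℤ) : Set JIdx :=
  {j | match j with
    | Sum.inl x => x = i + 1
    | Sum.inr (Sum.inl _) => True
    | Sum.inr (Sum.inr (Sum.inl f)) => f 0 = i ∨ f 0 = i + 1
    | Sum.inr (Sum.inr (Sum.inr (Sum.inl f))) => f 0 = i ∨ f 0 = i + 1
    | Sum.inr (Sum.inr (Sum.inr (Sum.inr f))) => f 0 = i ∨ f 0 = i + 1}

/-- The isotropic face column. [folklore] -/
def isoC (i : ℤ) (τ : Bool) : ℤ := if τ then i else i + 1

/-- The honeycomb face column. [folklore] -/
def hcC (i : ℤ) (τ : Bool) : ℤ := if τ then i + 1 else i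

/-- THE EMBEDDING OF THE CORE BITS into the coded gauge (`τ = true`: face column `i` isotropic). [folklore] -/
def ιc (i : ℤ) (τ : Bool) : Idx → JIdx := fun idx =>
  if idx.1 = 0 then Sum.inr (Sum.inl idx.2)
  else if idx.1 = 1 then Sum.inr (Sum.inr (Sum.inl ![isoC i τ, idx.2]))
  else if idx.1 = 2 then Sum.inr (Sum.inr (Sum.inr (Sum.inr ![isoC i τ, idx.2])))
  else if idx.1 = 3 then Sum.inr (Sum.inr (Sum.inr (Sum.inl ![hcC i τ, idx.2])))
  else Sum.inl (i + idx.2)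

/-- The core bits read off a coded gauge configuration. [folklore] -/
def coreOf (i : ℤ) (τ : Bool) (c : KJ) : K := fun idx => c (ιc i τ idx)

/-- Values of the embedding. [folklore] -/
theorem ιc_apply (i : ℤ) (τ : Bool) (y : ℤ) :
    ιc i τ (0, y) = Sum.inr (Sum.inl y) ∧ ιc i τ (1, y) = Sum.inr (Sum.inr (Sum.inl ![isoC i τ, y])) ∧
    ιc i τ (2, y) = Sum.inr (Sum.inr (Sum.inr (Sum.inr ![isoC i τ, y]))) ∧
    ιc i τ (3, y) = Sum.inr (Sum.inr (Sum.inr (Sum.inl ![hcC i τ, y]))) ∧ ιc i τ (4, y) = Sum.inl (i + y) := by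
  simp [ιc]

/-- The embedding is injective. [folklore] -/
theorem ιc_injective (i : ℤ) (τ : Bool) : Function.Injective (ιc i τ) := by
  rintro ⟨k, y⟩ ⟨k', y'⟩ h
  have hv : ∀ a b a' b' : ℤ, (![a, b] : Site 2) = ![a', b'] → a = a' ∧ b = b' := fun a b a' b' e =>
    ⟨by simpa using congrFun e 0, by simpa using congrFun e 1⟩
  fin_cases k <;> fin_cases k' <;>
    simp only [ιc, Fin.zero_eta, Fin.mk_one, Fin.reduceFinMk, Fin.isValue, if_true, if_false,
      show ((1 : Fin 5)) ≠ 0 by decide, show ((2 : Fin 5)) ≠ 0 by decide, show ((2 : Fin 5)) ≠ 1 by decide,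
      show ((3 : Fin 5)) ≠ 0 by decide, show ((3 : Fin 5)) ≠ 1 by decide, show ((3 : Fin 5)) ≠ 2 by decide,
      show ((4 : Fin 5)) ≠ 0 by decide, show ((4 : Fin 5)) ≠ 1 by decide, show ((4 : Fin 5)) ≠ 2 by decide,
      show ((4 : Fin 5)) ≠ 3 by decide, Sum.inl.injEq, Sum.inr.injEq, reduceCtorEq] at h ⊢
  · cases h; rfl
  · obtain ⟨-, rfl⟩ := hv _ _ _ _ h; rfl
  · obtain ⟨-, rfl⟩ := hv _ _ _ _ h; rfl
  · obtain ⟨-, rfl⟩ := hv _ _ _ _ h; rfl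
  · have e : y = y' := by omega
    subst e; rfl

/-- The densities of the embedded bits are those of the core law. [folklore] -/
theorem wJ_ιc (i : ℤ) (τ : Bool) (idx : Idx) : wJ (ιc i τ idx) = wt idx.1 := by
  obtain ⟨k, y⟩ := idx
  fin_cases k <;> simp [ιc, wJ, wt]

/-- THE LAW OF THE CORE BITS read off the coded gauge is the core law `P`. [folklore] -/
theorem map_coreOf (i : ℤ) (τ : Bool) : PJ.map (coreOf i τ) = P := by
  unfold PJ coreOf
  rw [Measure.map_infinitePi_infinitePi_of_inj (ιc_injective i τ)]
  unfold P
  congr 1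
  funext idx
  rw [wJ_ιc]

/-- `coreOf` is measurable. [folklore] -/
theorem measurable_coreOf (i : ℤ) (τ : Bool) : Measurable (coreOf i τ) :=
  measurable_pi_lambda _ fun _ => measurable_pi_apply _

/-- The bits the strip model reads are middle coordinates of the coded gauge. [folklore] -/
theorem ιc_mem_Amid (i : ℤ) (τ : Bool) (k : Fin 5) (y : ℤ) (hk : k ≠ 4 ∨ y = 1) : ιc i τ (k, y) ∈ Amid i := by
  obtain ⟨e0, e1, e2, e3, e4⟩ := ιc_apply i τ y
  fin_cases k
  · simp only [Fin.zero_eta, e0, Amid, Set.mem_setOf_eq]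
  · simp only [Fin.mk_one, e1, Amid, Set.mem_setOf_eq, Matrix.cons_val_zero, isoC]; cases τ <;> simp
  · simp only [Fin.reduceFinMk, e2, Amid, Set.mem_setOf_eq, Matrix.cons_val_zero, isoC]; cases τ <;> simp
  · simp only [Fin.reduceFinMk, e3, Amid, Set.mem_setOf_eq, Matrix.cons_val_zero, hcC]; cases τ <;> simp
  · rcases hk with hk | rfl
    · exact absurd rfl hk
    · simp only [Fin.reduceFinMk, e4, Amid, Set.mem_setOf_eq]

/-- The strip observables only read the bits of kinds `0–3` and the bit `(4, 1)`. [folklore] -/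
theorem X_congr (i : ℤ) (τ κ₀ κ₂ : Bool) {c c' : K} (h : ∀ (k : Fin 5) (y : ℤ), (k ≠ 4 ∨ y = 1) → c (k, y) = c' (k, y)) :
    X i τ κ₀ κ₂ c = X i τ κ₀ κ₂ c' ∧ bdry κ₀ κ₂ c = bdry κ₀ κ₂ c' := by
  have hcol : ∀ j y, col τ κ₀ κ₂ c j y = col τ κ₀ κ₂ c' j y := by
    intro j y
    have h0 : c (0, y) = c' (0, y) := h 0 y (Or.inl (by decide))
    have h4 : c (4, 1) = c' (4, 1) := h 4 1 (Or.inr rfl)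
    have hk : ∀ k : Fin 5, k ≠ 4 → (fun s => c (k, s)) = fun s => c' (k, s) := fun k hk => funext fun s => h k s (Or.inl hk)
    have h13 : ∀ τ' : Bool, kL τ' ≠ 4 := by decide
    fin_cases j
    · simp only [Fin.zero_eta, col_zero, h0]
    · simp only [Fin.mk_one, col_one, h0, h4, hk _ (h13 τ)]
    · simp only [Fin.reduceFinMk, col_two, h0, hk 1 (by decide), hk 3 (by decide)]
  have hflag : ∀ j y, flag τ c j y = flag τ c' j y := by
    intro j y
    have h2 : c (2, y) = c' (2, y) := h 2 y (Or.inl (by decide))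
    fin_cases j <;> simp [h2]
  refine ⟨Prod.ext (Set.ext fun v => ?_) (Set.ext fun f => ?_), ?_⟩
  · simp only [X, Set.mem_setOf_eq, hcol]
  · simp only [X, Set.mem_setOf_eq, hflag]
  · rw [bdry_eq τ, bdry_eq τ]
    exact Prod.ext (funext fun y => hcol 0 y) (funext fun y => hcol 2 y)

/-- In a glued configuration, the strip model reads the second sample. [folklore] -/
theorem X_coreOf_glue (i : ℤ) (τ κ₀ κ₂ : Bool) (b₁ b₂ : KJ) :
    X i τ κ₀ κ₂ (coreOf i τ (glue (Amid i) b₁ b₂)) = X i τ κ₀ κ₂ (coreOf i τ b₂) ∧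
      bdry κ₀ κ₂ (coreOf i τ (glue (Amid i) b₁ b₂)) = bdry κ₀ κ₂ (coreOf i τ b₂) :=
  X_congr i τ κ₀ κ₂ fun k y hk => by simp only [coreOf, glue, if_pos (ιc_mem_Amid i τ k y hk)]

/-! ## §6 The strip of the coded observables IS the explicit strip model -/

/-- `Xor` of bit tests. [folklore] -/
theorem xor_eq_true (a b : Bool) : Xor (a = true) (b = true) ↔ (a ^^ b) = true := by
  cases a <;> cases b <;> decide

/-- Anchored parities as odd counts. [folklore] -/
theorem bp_eq_true_iff (f : ℤ → Bool) (y : ℤ) [DecidablePred fun s => f s = true] :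
    bp f 0 y = true ↔ Odd (((Finset.Ico (min 0 y) (max 0 y)).filter fun s => f s = true).card) := by
  unfold bp
  rw [decide_eq_true_eq, ← ZMod.natCast_eq_one_iff_odd, Finset.natCast_card_filter]
  refine Eq.congr_left (Finset.sum_congr rfl fun s _ => ?_)
  unfold bz; by_cases hfs : f s = true <;> simp [hfs]

/-- Marks in a one-column strip. [folklore] -/
theorem odd_card_singleton_product (P : ℤ × ℤ → Prop) [DecidablePred P] (a : ℤ) (B : Finset ℤ) :
    Odd ((({a} : Finset ℤ) ×ˢ B).filter P).card ↔ Odd ((B.filter fun s => P (a, s)).card) := by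
  rw [Finset.singleton_product, Finset.filter_map, Finset.card_map]
  rfl

/-- Parity of a sum. [folklore] -/
theorem odd_add_xor (m n : ℕ) : Odd (m + n) ↔ Xor (Odd m) (Odd n) := by
  rw [Nat.odd_add, ← Nat.not_odd_iff_even]
  unfold Xor; tauto

/-- Marks in a two-column strip. [folklore] -/
theorem odd_card_pair_product (P : ℤ × ℤ → Prop) [DecidablePred P] (a : ℤ) (B : Finset ℤ) :
    Odd (((Finset.Ico a (a + 2)) ×ˢ B).filter P).card ↔
      Xor (Odd ((B.filter fun s => P (a, s)).card)) (Odd ((B.filter fun s => P (a + 1, s)).card)) := by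
  have e : Finset.Ico a (a + 2) = {a} ∪ {a + 1} := by
    ext x; simp only [Finset.mem_Ico, Finset.mem_union, Finset.mem_singleton]; omega
  have hd : Disjoint ((({a} : Finset ℤ) ×ˢ B).filter P) ((({a + 1} : Finset ℤ) ×ˢ B).filter P) :=
    Finset.disjoint_filter_filter (Finset.disjoint_left.2 fun x h1 h2 => by
      rw [Finset.mem_product, Finset.mem_singleton] at h1 h2; omega)
  rw [e, Finset.union_product, Finset.filter_union, Finset.card_union_of_disjoint hd, odd_add_xor,
    odd_card_singleton_product, odd_card_singleton_product]

/-- The plaquettes of face column `i` read by the model are the core plaquettes of kind `kL`. [folklore] -/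
theorem parJ_colL (i : ℤ) (S : Set ℤ) (c : KJ) (s : ℤ) :
    parJ S c ![i, s] = coreOf i (decide (i ∈ S)) c (kL (decide (i ∈ S)), s) := by
  by_cases hi : i ∈ S
  · simp [parJ, hi, coreOf, kL, (ιc_apply i true s).2.1, isoC]
  · simp [parJ, hi, coreOf, kL, (ιc_apply i false s).2.2.2.1, hcC]

/-- The plaquettes of face column `i+1` read by the model are the core plaquettes of kind `kR`. [folklore] -/
theorem parJ_colR (i : ℤ) (S : Set ℤ) (h : i ∈ S ↔ i + 1 ∉ S) (c : KJ) (s : ℤ) :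
    parJ S c ![i + 1, s] = coreOf i (decide (i ∈ S)) c (kR (decide (i ∈ S)), s) := by
  by_cases hi : i ∈ S
  · have hi' : i + 1 ∉ S := h.1 hi
    simp [parJ, hi, hi', coreOf, kR, (ιc_apply i true s).2.2.2.1, hcC]
  · have hi' : i + 1 ∈ S := by by_contra h'; exact hi (h.2 h')
    simp [parJ, hi, hi', coreOf, kR, (ιc_apply i false s).2.1, isoC]

/-- `Xor` with `False`. [folklore] -/
theorem xor_False (Q : Prop) : Xor Q False ↔ Q := by unfold Xor; tauto

/-- STRIP COLOURS, column `i`. [folklore] -/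
theorem memObsJ_col0 (i : ℤ) (S : Set ℤ) (τ : Bool) (c : KJ) (v : Site 2) (hv : v 0 = i) :
    v ∈ (ObsJ i S c).1 ↔ col τ (c (Sum.inl i)) (c (Sum.inl (i + 2))) (coreOf i τ c) 0 (v 1) = true := by
  have e0 : coreOf i τ c (0, v 1) = c (Sum.inr (Sum.inl (v 1))) := by simp [coreOf, (ιc_apply i τ (v 1)).1]
  simp only [ObsJ, Set.mem_setOf_eq]
  rw [hv, min_self, max_self, Finset.Ico_self, Finset.empty_product, Finset.filter_empty, Finset.card_empty, col_zero, e0]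
  simp only [Nat.not_odd_zero, xor_False]
  exact xor_eq_true _ _

/-- STRIP COLOURS, column `i+1`. [folklore] -/
theorem memObsJ_col1 (i : ℤ) (S : Set ℤ) (c : KJ) (v : Site 2) (hv : v 0 = i + 1) :
    v ∈ (ObsJ i S c).1 ↔
      col (decide (i ∈ S)) (c (Sum.inl i)) (c (Sum.inl (i + 2))) (coreOf i (decide (i ∈ S)) c) 1 (v 1) = true := by
  set τ := decide (i ∈ S) with hτ
  have e0 : coreOf i τ c (0, v 1) = c (Sum.inr (Sum.inl (v 1))) := by simp [coreOf, (ιc_apply i τ (v 1)).1]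
  have e4 : coreOf i τ c (4, 1) = c (Sum.inl (i + 1)) := by simp [coreOf, (ιc_apply i τ 1).2.2.2.2]
  simp only [ObsJ, Set.mem_setOf_eq]
  rw [hv, min_eq_left (by omega), max_eq_right (by omega), Finset.Ico_add_one_right_eq_Icc, Finset.Icc_self,
    odd_card_singleton_product, col_one, e0, e4]
  simp only [parJ_colL, ← hτ]
  rw [← bp_eq_true_iff, xor_eq_true, xor_eq_true, Bool.xor_assoc]

/-- STRIP COLOURS, column `i+2`. [folklore] -/
theorem memObsJ_col2 (i : ℤ) (S : Set ℤ) (h : i ∈ S ↔ i + 1 ∉ S) (c : KJ) (v : Site 2) (hv : v 0 = i + 2) :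
    v ∈ (ObsJ i S c).1 ↔
      col (decide (i ∈ S)) (c (Sum.inl i)) (c (Sum.inl (i + 2))) (coreOf i (decide (i ∈ S)) c) 2 (v 1) = true := by
  set τ := decide (i ∈ S) with hτ
  have e0 : coreOf i τ c (0, v 1) = c (Sum.inr (Sum.inl (v 1))) := by simp [coreOf, (ιc_apply i τ (v 1)).1]
  simp only [ObsJ, Set.mem_setOf_eq]
  rw [hv, min_eq_left (by omega), max_eq_right (by omega), odd_card_pair_product, col_two, e0]
  simp only [parJ_colL, parJ_colR i S h, ← hτ]
  rw [← bp_eq_true_iff, ← bp_eq_true_iff, xor_eq_true, xor_eq_true, xor_eq_true, Bool.xor_assoc (c (Sum.inl (i + 2)) ^^ _),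
    bp_one_three τ, Bool.xor_assoc]

/-- STRIP FLAGS, face column `i`. [folklore] -/
theorem memObsJ2_col0 (i : ℤ) (S : Set ℤ) (c : KJ) (f : Site 2) (hf : f 0 = i) :
    f ∈ (ObsJ i S c).2 ↔ flag (decide (i ∈ S)) (coreOf i (decide (i ∈ S)) c) 0 (f 1) = true := by
  have hff : (![i, f 1] : Site 2) = f := by rw [← hf]; exact site2_eta f
  simp only [ObsJ, Set.mem_setOf_eq, hf]
  by_cases hi : i ∈ S
  · simp [hi, coreOf, (ιc_apply i true (f 1)).2.2.1, isoC, hff]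
  · simp [hi]

/-- STRIP FLAGS, face column `i+1`. [folklore] -/
theorem memObsJ2_col1 (i : ℤ) (S : Set ℤ) (h : i ∈ S ↔ i + 1 ∉ S) (c : KJ) (f : Site 2) (hf : f 0 = i + 1) :
    f ∈ (ObsJ i S c).2 ↔ flag (decide (i ∈ S)) (coreOf i (decide (i ∈ S)) c) 1 (f 1) = true := by
  have hff : (![i + 1, f 1] : Site 2) = f := by rw [← hf]; exact site2_eta f
  simp only [ObsJ, Set.mem_setOf_eq, hf]
  by_cases hi : i ∈ S
  · have hi' : i + 1 ∉ S := h.1 hi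
    simp [hi, hi']
  · have hi' : i + 1 ∈ S := by by_contra h'; exact hi (h.2 h')
    simp [hi, hi', coreOf, (ιc_apply i false (f 1)).2.2.1, isoC, hff]

/-- The strip diagram only reads the strip. [folklore] -/
theorem stripDiagram_congr (i : ℤ) {x x' : Obs} (h1 : ∀ v : Site 2, i ≤ v 0 → v 0 ≤ i + 2 → (v ∈ x.1 ↔ v ∈ x'.1))
    (h2 : ∀ f : Site 2, (f 0 = i ∨ f 0 = i + 1) → (f ∈ x.2 ↔ f ∈ x'.2)) : stripDiagram i x ⊆ stripDiagram i x' := by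
  rintro ⟨p, q⟩ hpq
  rw [mem_stripDiagram_iff] at hpq ⊢
  obtain ⟨hp, hq, ⟨hqc, hq0, hq0'⟩, ⟨-, hp0, hp0'⟩, hr⟩ := hpq
  have hpc : p ∈ x.1 ↔ p ∈ x'.1 := h1 p hp0 hp0'
  have hset : cls x i p ⊆ cls x' i p := fun v ⟨hv, hv0, hv0'⟩ => ⟨by rw [← h1 v hv0 hv0', ← hpc]; exact hv, hv0, hv0'⟩
  refine ⟨hp, hq, ⟨by rw [← h1 q hq0 hq0', ← hpc]; exact hqc, hq0, hq0'⟩, ⟨Iff.rfl, hp0, hp0'⟩,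
    within_mono _ hset (within_mono_graph _ (fun u v hu hv huv => ?_) hr)⟩
  rw [cellGraph_adj_iff] at huv ⊢
  refine (grid_adj_map _ _ 0 0 (u 0, u 1) (v 0, v 1) (fun c d hc _ => ?_)).1 huv |> fun e => by simpa using e
  simp only at hc
  rw [add_zero, add_zero]
  exact h2 _ (by simp; have := hu.2.1; have := hu.2.2; have := hv.2.1; have := hv.2.2; omega)

/-- THE STRIP DIAGRAM OF THE CODED OBSERVABLES is the strip diagram of the explicit strip model read off the core bits. [folklore] -/
theorem stripDiagram_ObsJ (i : ℤ) (S : Set ℤ) (h : i ∈ S ↔ i + 1 ∉ S) (c : KJ) :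
    stripDiagram i (ObsJ i S c) = stripDiagram i (X i (decide (i ∈ S)) (c (Sum.inl i)) (c (Sum.inl (i + 2))) (coreOf i (decide (i ∈ S)) c)) := by
  have h1 : ∀ v : Site 2, i ≤ v 0 → v 0 ≤ i + 2 →
      (v ∈ (ObsJ i S c).1 ↔ v ∈ (X i (decide (i ∈ S)) (c (Sum.inl i)) (c (Sum.inl (i + 2))) (coreOf i (decide (i ∈ S)) c)).1) := by
    intro v hv hv'
    rcases (show v 0 = i ∨ v 0 = i + 1 ∨ v 0 = i + 2 by omega) with e | e | e
    · rw [mem_X_iff i _ _ _ _ v 0 (by simp [e]), memObsJ_col0 i S _ c v e]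
    · rw [mem_X_iff i _ _ _ _ v 1 (by simp [e]), memObsJ_col1 i S c v e]
    · rw [mem_X_iff i _ _ _ _ v 2 (by simp [e]), memObsJ_col2 i S h c v e]
  have h2 : ∀ f : Site 2, (f 0 = i ∨ f 0 = i + 1) →
      (f ∈ (ObsJ i S c).2 ↔ f ∈ (X i (decide (i ∈ S)) (c (Sum.inl i)) (c (Sum.inl (i + 2))) (coreOf i (decide (i ∈ S)) c)).2) := by
    intro f hf
    rcases hf with e | e
    · rw [mem_X2_iff i _ _ _ _ f 0 (by simp [e]), memObsJ2_col0 i S c f e]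
    · rw [mem_X2_iff i _ _ _ _ f 1 (by simp [e]), memObsJ2_col1 i S h c f e]
  exact Set.Subset.antisymm (stripDiagram_congr i h1 h2)
    (stripDiagram_congr i (fun v hv hv' => (h1 v hv hv').symm) (fun f hf => (h2 f hf).symm))


end SDE

/-- STRIP FACTORISATION (plumbing part 3 of `stub_StripDiagramExchange`): the strip diagram of the column-`i`-anchored observables of a coded gauge configuration is the strip diagram of the explicit strip model read off its core bits. [folklore] -/
theorem stripDX_stripFactor : ∀ (i : ℤ) (S : Set ℤ), (i ∈ S ↔ i + 1 ∉ S) → ∀ (c : SDE.KJ), stripDiagram i (SDE.ObsJ i S c) = stripDiagram i (SDE.X i (decide (i ∈ S)) (c (Sum.inl i)) (c (Sum.inl (i + 2))) (SDE.coreOf i (decide (i ∈ S)) c)) :=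
  fun i S h c => SDE.stripDiagram_ObsJ i S h c

end Summit.CriticalPhenomena.CardyFormulaZ2.Theorems.IKLinearTransport.PinnedDiagramExchange
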